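import Literature.MathematicalPhysics.QuantumFieldTheory.OSLorentzInvariance
import Literature.MathematicalPhysics.QuantumLattice.WightmanPermutedTubeLocal
import HarnessLib

/-!
# The OS continuation on a permuted tube is the continuation composed with an imaginary boost

Topic `Literature/MathematicalPhysics/QuantumFieldTheory`, worker file in the decomposition of
the named fact `Literature.MathematicalPhysics.QuantumFieldTheory.OS1973_local` (locality (R3) of
the Osterwalder–Schrader boundary values, conjunct of `os_reconstruction`; Osterwalder–Schrader I
(1973), §4.5: "`𝔚ₙ(z₁, …, zₙ)` is symmetric in its arguments and has an `L↑₊` invariant, single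
valued, symmetric analytic continuation into the domain `$ₙ = ⋃_π π𝒯ₙ` … This follows easily from
the symmetry property (E2) [sic: the symmetry axiom is (E3), OS I p. 86] for the Euclidean Green's
functions and Eqs. (4.1), (4.12) and (4.14).
Using the Bargmann Hall Wightman theorem, we conclude that `𝔚ₙ` allows even a single valued,
symmetric `L₊(ℂ)` invariant analytic continuation into the domain `S'ₙ = ⋃_{Λ ∈ L₊(ℂ)} Λ$ₙ`").

The elementary core of this statement — the one place where the symmetry (E3) and the Euclidean
rotation invariance (E1) enter — is proved here as a **functional equation on the forward tube**:
let `𝔚` be the OS continuation of `𝔖ₙ` (holomorphic on `𝒯ₙ`, `𝔖ₙ(F) = ∫ 𝔚(ιx) F(x) dx` for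
time-ordered `F`), `σ` a permutation of the `n` points and `B = B_i(iφ)` the complex boost of
imaginary rapidity `iφ` in the `(0, i)`-plane (`boostC`, `OSLorentzInvariance`). Then

  `𝔚 (z ∘ σ) = 𝔚 (B z)` whenever both `z ∘ σ ∈ 𝒯ₙ` and `B z ∈ 𝒯ₙ`

(`apply_perm_eq_apply_boostC`). In words: on the intersection `D = σ𝒯ₙ ∩ B⁻¹𝒯ₙ` of the
permuted tube with the pull-back of the tube by the complex Lorentz transformation `B`, the
"permuted continuation" `z ↦ 𝔚(z ∘ σ)` and the "transported continuation" `z ↦ 𝔚(B z)` agree —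
which is the consistency needed to glue them into a single-valued function on `σ𝒯ₙ ∪ B⁻¹𝒯ₙ`, and
which, combined with the `L₊(ℂ)`-invariance of the Bargmann–Hall–Wightman continuation, identifies
the permuted continuation with the BHW continuation near the points used in the proof of locality
(`OSLocality`).

Proof. `D` is convex and open. At the Euclidean points `ιw ∈ D` (`w ∘ σ` and the Euclidean
rotation `R_φ w` both time-ordered; `B ιw = ι(R_φ w)`, `boostC_mul_I_euclideanPoint`) both
functions are densities of `𝔖ₙ`: against a test function `F` supported in the open set of such
`w`, `∫ 𝔚(ι(w ∘ σ)) F = 𝔖ₙ(F ∘ σ⁻¹) = 𝔖ₙ(F)` (permutation invariance of Lebesgue measure, E3) and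
`∫ 𝔚(ι(R_φ w)) F = 𝔖ₙ(F ∘ R_φ⁻¹) = 𝔖ₙ(F)` (rotation invariance of Lebesgue measure, E1), so they
agree there (`apply_euclideanPoint_perm_eq_planeRot`, via `eqOn_of_integral_mul_eq_of_isOpen`; the E1
half is the computation of `apply_euclideanPoint_planeRot_eq`, `OSLorentzInvariance`, repeated here
because that lemma assumes `w` itself time-ordered).
The Euclidean points are a set of uniqueness for `D`: the Euclidean "real part" `ι(Re_E z)` of a
point of `D` lies again in `D`, and on the complex line through `ι(Re_E z)` and `z` the difference
vanishes at the real parameters near `0` (`eqOn_zero_of_euclidean_of_convex`, the argument of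
`eqOn_zero_forwardTube_of_euclidean` for a general convex domain stable under `z ↦ ι(Re_E z)`).

## References

* K. Osterwalder, R. Schrader, *Axioms for Euclidean Green's functions*, Comm. Math. Phys. 31
  (1973) 83–112, §4.5 (p. 97). [OsterwalderSchraderCMP1973]
* R. F. Streater, A. S. Wightman, *PCT, Spin and Statistics, and All That* (1964), §2-4
  (complex Lorentz transformations (2-91)), §2-3 (real environments). [StreaterWightman1964]
-/

noncomputable section

open MeasureTheory Filter Complex Set
open _root_.Topology
open scoped SchwartzMap
open Literature.MathematicalPhysics.QuantumLattice Literature.MathematicalPhysics.QuantumFieldTheory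

namespace Literature.MathematicalPhysics.QuantumFieldTheory

variable {d n : ℕ}

/-! ### Linearity of the complex boost in the configuration -/

/-- The complex boost is additive in the vector. [folklore] -/
theorem boostC_add_arg (i : Fin d) (w : ℂ) (a b : Fin (d + 1) → ℂ) :
    boostC i w (a + b) = boostC i w a + boostC i w b := by
  ext j
  simp only [boostC, Pi.add_apply]
  split_ifs <;> ring

/-- The complex boost is `ℂ`-homogeneous in the vector. [folklore] -/
theorem boostC_smul_arg (i : Fin d) (w c : ℂ) (a : Fin (d + 1) → ℂ) :
    boostC i w (c • a) = c • boostC i w a := by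
  ext j
  simp only [boostC, Pi.smul_apply, smul_eq_mul]
  split_ifs <;> ring

/-- The complex boost is `ℝ`-homogeneous in the vector. [folklore] -/
theorem boostC_smul_real_arg (i : Fin d) (w : ℂ) (c : ℝ) (a : Fin (d + 1) → ℂ) :
    boostC i w (c • a) = c • boostC i w a := by
  rw [← Complex.coe_smul, boostC_smul_arg, Complex.coe_smul]

variable (n) in
/-- The diagonal complex boost of a configuration, `(B z)_k = B_i(w) z_k`. [folklore] -/
def boostConfig (i : Fin d) (w : ℂ) (z : Fin n → Fin (d + 1) → ℂ) : Fin n → Fin (d + 1) → ℂ :=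
  fun k => boostC i w (z k)

/-- Components of `boostConfig`. [folklore] -/
@[simp] theorem boostConfig_apply (i : Fin d) (w : ℂ) (z : Fin n → Fin (d + 1) → ℂ) (k : Fin n) :
    boostConfig n i w z k = boostC i w (z k) := rfl

/-- The diagonal boost is additive. [folklore] -/
theorem boostConfig_add (i : Fin d) (w : ℂ) (z z' : Fin n → Fin (d + 1) → ℂ) :
    boostConfig n i w (z + z') = boostConfig n i w z + boostConfig n i w z' := by
  funext k; simp [boostC_add_arg]

/-- The diagonal boost is `ℂ`-homogeneous. [folklore] -/
theorem boostConfig_smul (i : Fin d) (w c : ℂ) (z : Fin n → Fin (d + 1) → ℂ) :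
    boostConfig n i w (c • z) = c • boostConfig n i w z := by
  funext k; simp [boostC_smul_arg]

/-- The diagonal boost is `ℝ`-homogeneous. [folklore] -/
theorem boostConfig_smul_real (i : Fin d) (w : ℂ) (c : ℝ) (z : Fin n → Fin (d + 1) → ℂ) :
    boostConfig n i w (c • z) = c • boostConfig n i w z := by
  funext k; simp [boostC_smul_real_arg]

/-- The diagonal boost is continuous in the configuration. [folklore] -/
theorem continuous_boostConfig (i : Fin d) (w : ℂ) :
    Continuous (boostConfig n i w : (Fin n → Fin (d + 1) → ℂ) → _) := by
  refine continuous_pi fun k => continuous_pi fun j => ?_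
  simp only [boostConfig_apply, boostC]
  split_ifs <;> fun_prop

/-- The diagonal boost is complex-differentiable in the configuration (it is `ℂ`-linear).
[folklore] -/
theorem differentiable_boostConfig (i : Fin d) (w : ℂ) :
    Differentiable ℂ (boostConfig n i w : (Fin n → Fin (d + 1) → ℂ) → _) := by
  refine differentiable_pi.2 fun k => differentiable_pi.2 fun j => ?_
  simp only [boostConfig_apply, boostC]
  split_ifs <;> fun_prop

/-- **Imaginary rapidity rotates Euclidean configurations**:
`B_i(iφ) ι(x) = ι(R_φ x)` (`boostC_mul_I_euclideanPoint`, configuration form). [folklore] -/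
theorem boostConfig_mul_I_euclideanPoint (i : Fin d) (φ : ℝ)
    (x : Fin n → EuclideanSpace ℝ (Fin (d + 1))) :
    boostConfig n i ((φ : ℂ) * I) (euclideanPoint x) = euclideanPoint fun k => planeRot i φ (x k) :=
  funext fun k => boostC_mul_I_euclideanPoint i φ x k

/-! ### Euclidean real parts -/

/-- The Euclidean real part of `ιa + i ιb` is `a`. [folklore] -/
theorem euclideanRe_euclideanPoint_add (a b : Fin n → EuclideanSpace ℝ (Fin (d + 1))) :
    euclideanRe (euclideanPoint a + (I : ℂ) • euclideanPoint b) = a := by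
  funext k
  ext μ
  by_cases hμ : μ = 0
  · subst hμ
    simp [euclideanRe]
  · simp [euclideanRe, euclideanPoint, hμ]

/-- The Euclidean real part of a Euclidean point is the configuration. [folklore] -/
theorem euclideanRe_euclideanPoint (a : Fin n → EuclideanSpace ℝ (Fin (d + 1))) :
    euclideanRe (euclideanPoint a) = a := by
  funext k
  ext μ
  by_cases hμ : μ = 0
  · subst hμ
    simp [euclideanRe]
  · simp [euclideanRe, euclideanPoint, hμ]

/-- The Euclidean real part commutes with permutations of the points. [folklore] -/
theorem euclideanRe_comp_perm (σ : Equiv.Perm (Fin n)) (z : Fin n → Fin (d + 1) → ℂ) :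
    euclideanRe (fun k => z (σ k)) = fun k => euclideanRe z (σ k) := rfl

/-- **The Euclidean real part of a boosted configuration** (imaginary rapidity) is the rotated
Euclidean real part: `Re_E (B_i(iφ) z) = R_φ (Re_E z)`. [folklore] -/
theorem euclideanRe_boostConfig_mul_I (i : Fin d) (φ : ℝ) (z : Fin n → Fin (d + 1) → ℂ) :
    euclideanRe (boostConfig n i ((φ : ℂ) * I) z) = fun k => planeRot i φ (euclideanRe z k) := by
  conv_lhs => rw [← euclideanPoint_euclideanRe_add z]
  rw [boostConfig_add, boostConfig_smul, boostConfig_mul_I_euclideanPoint,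
    boostConfig_mul_I_euclideanPoint, euclideanRe_euclideanPoint_add]

/-- A Euclidean point lies in the forward tube iff the configuration is time-ordered. [folklore] -/
theorem euclideanPoint_mem_forwardTube_iff {x : Fin n → EuclideanSpace ℝ (Fin (d + 1))} :
    euclideanPoint x ∈ forwardTube d n ↔ x ∈ timeOrderedRegion d n := by
  refine ⟨fun h => ?_, fun h => mapsTo_euclideanPoint_timeOrderedRegion h⟩
  simpa [euclideanRe_euclideanPoint] using euclideanRe_mem_timeOrderedRegion h

/-! ### The identity theorem from Euclidean points on a convex domain -/

/-- **Identity theorem from Euclidean points on a convex domain.** Let `D` be a convex open set of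
complex configurations which contains, with every point `z`, the Euclidean point `ι(Re_E z)` of
its Euclidean real part. A function holomorphic on `D` vanishing at all Euclidean points of `D`
vanishes on `D` (on the complex line `t ↦ ι(Re_E z) + t ι(Im_E z)` through `ι(Re_E z)` (`t = 0`)
and `z` (`t = i`) the function vanishes for real `t` near `0`, these being Euclidean points of `D`;
the set of admissible `t` is convex; one-variable identity theorem). This is
`eqOn_zero_forwardTube_of_euclidean` with `𝒯ₙ` replaced by `D`. [cite: StreaterWightman1964, §2-3] -/
theorem eqOn_zero_of_euclidean_of_convex {D : Set (Fin n → Fin (d + 1) → ℂ)} (hDo : IsOpen D)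
    (hDc : Convex ℝ D) (hP : ∀ z ∈ D, euclideanPoint (euclideanRe z) ∈ D)
    {g : (Fin n → Fin (d + 1) → ℂ) → ℂ} (hg : DifferentiableOn ℂ g D)
    (h0 : ∀ w : Fin n → EuclideanSpace ℝ (Fin (d + 1)), euclideanPoint w ∈ D → g (euclideanPoint w) = 0) :
    Set.EqOn g 0 D := by
  intro z hz
  set x := euclideanRe z with hx_def
  set y := euclideanIm z with hy_def
  have hzxy : euclideanPoint x + (I : ℂ) • euclideanPoint y = z := euclideanPoint_euclideanRe_add z
  have hx : euclideanPoint x ∈ D := hP z hz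
  set γ : ℂ → (Fin n → Fin (d + 1) → ℂ) := fun t => euclideanPoint x + t • euclideanPoint y with hγ
  have hγd : Differentiable ℂ γ := (differentiable_const _).add (differentiable_id.smul_const _)
  set Dγ : Set ℂ := γ ⁻¹' D with hDγ
  have hDo' : IsOpen Dγ := hDo.preimage hγd.continuous
  have hDc' : Convex ℝ Dγ := by
    intro s hs t ht a b ha hb hab
    show γ (a • s + b • t) ∈ D
    have hab' : (a : ℂ) + b = 1 := by exact_mod_cast hab
    have : γ (a • s + b • t) = a • γ s + b • γ t := by
      funext k μ
      simp only [hγ, Pi.add_apply, Pi.smul_apply, smul_eq_mul, Complex.real_smul]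
      linear_combination (euclideanPoint x k μ) * hab'.symm
    rw [this]
    exact hDc hs ht ha hb hab
  have h0D : (0 : ℂ) ∈ Dγ := by
    show γ 0 ∈ D
    simpa only [hγ, zero_smul, add_zero] using hx
  have hID : I ∈ Dγ := by
    show γ I ∈ D
    simpa only [hγ, hzxy] using hz
  have hφ : AnalyticOnNhd ℂ (g ∘ γ) Dγ :=
    (hg.comp hγd.differentiableOn (Set.mapsTo_preimage γ _)).analyticOnNhd hDo'
  have hreal : ∀ᶠ t : ℝ in 𝓝 0, (g ∘ γ) (t : ℂ) = 0 := by
    have hcont : Continuous fun t : ℝ => euclideanPoint (x + t • y) :=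
      continuous_euclideanPoint.comp (continuous_const.add (continuous_id.smul continuous_const))
    have hmem : ∀ᶠ t : ℝ in 𝓝 0, euclideanPoint (x + t • y) ∈ D := by
      refine hcont.continuousAt.eventually_mem (hDo.mem_nhds ?_)
      simpa using hx
    filter_upwards [hmem] with t ht
    simp only [Function.comp_apply, hγ, euclideanPoint_add_real_smul]
    exact h0 _ ht
  have hfreq : ∃ᶠ t in 𝓝[≠] (0 : ℂ), (g ∘ γ) t = 0 := by
    have htend : Tendsto (fun t : ℝ => (t : ℂ)) (𝓝[≠] 0) (𝓝[≠] 0) := by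
      refine (continuous_ofReal.continuousWithinAt).tendsto_nhdsWithin ?_
      intro t ht
      simpa using ht
    exact htend.frequently (eventually_nhdsWithin_of_eventually_nhds hreal).frequently
  have := hφ.eqOn_zero_of_preconnected_of_frequently_eq_zero hDc'.isPreconnected h0D hfreq hID
  simp only [Function.comp_apply, hγ, hzxy, Pi.zero_apply] at this
  simpa only [Pi.zero_apply] using this

/-! ### Euclidean points: the permuted and the rotated continuation agree -/

/-! Permutation of the integration variables (`integral_comp_perm_spaceTime`) and the support of
a permuted test function (`tsupport_permTest`, `permHomeo`) are taken from
`WightmanPermutedTubeLocal` (`SpaceTime d = EuclideanSpace ℝ (Fin (d + 1))`). -/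

variable {S : SchwingerFamily (EuclideanSpace ℝ (Fin (d + 1)))} {𝔚 : (Fin n → Fin (d + 1) → ℂ) → ℂ}

/-- **At Euclidean points the permuted and the rotated continuation agree** (E3 and E1 read
pointwise): if `w ∘ σ` and `R_φ w` are both time-ordered then `𝔚(ι(w ∘ σ)) = 𝔚(ι(R_φ w))`. On
the open set `U` of such `w` both sides are continuous; against `F` supported in `U`,
`∫ 𝔚(ι(w ∘ σ)) F(w) dw = ∫ 𝔚(ιv) F(v ∘ σ⁻¹) dv = 𝔖ₙ(F ∘ (· ∘ σ⁻¹)) = 𝔖ₙ(F)` by E3 and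
`∫ 𝔚(ι(R_φ w)) F(w) dw = 𝔖ₙ(F ∘ R_φ⁻¹) = 𝔖ₙ(F)` by E1 (both test functions being time-ordered);
conclude with `eqOn_of_integral_mul_eq_of_isOpen`. [cite: OsterwalderSchraderCMP1973, §4.5] -/
theorem apply_euclideanPoint_perm_eq_planeRot (hE1 : S.IsEuclideanCovariant) (hE3 : S.IsSymmetric)
    (h𝔚 : DifferentiableOn ℂ 𝔚 (forwardTube d n))
    (hS : ∀ F : 𝓢((Fin n → EuclideanSpace ℝ (Fin (d + 1))), ℂ), IsTimeOrdered F →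
      S n F = ∫ x, 𝔚 (euclideanPoint x) * F x)
    (σ : Equiv.Perm (Fin n)) (i : Fin d) (φ : ℝ) {w : Fin n → EuclideanSpace ℝ (Fin (d + 1))}
    (hwσ : (fun k => w (σ k)) ∈ timeOrderedRegion d n)
    (hwR : (fun k => planeRot i φ (w k)) ∈ timeOrderedRegion d n) :
    𝔚 (euclideanPoint fun k => w (σ k)) = 𝔚 (euclideanPoint fun k => planeRot i φ (w k)) := by
  set L := planeRot i φ with hL
  set ρ : (Fin n → EuclideanSpace ℝ (Fin (d + 1))) → (Fin n → EuclideanSpace ℝ (Fin (d + 1))) :=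
    fun x k => L (x k) with hρ
  set π : (Fin n → EuclideanSpace ℝ (Fin (d + 1))) → (Fin n → EuclideanSpace ℝ (Fin (d + 1))) :=
    fun x k => x (σ k) with hπ
  have hρc : Continuous ρ := continuous_pi fun k => L.continuous.comp (continuous_apply k)
  have hπc : Continuous π := continuous_pi fun k => continuous_apply (σ k)
  set U : Set (Fin n → EuclideanSpace ℝ (Fin (d + 1))) :=
    π ⁻¹' timeOrderedRegion d n ∩ ρ ⁻¹' timeOrderedRegion d n with hU
  have hUo : IsOpen U :=
    (isOpen_timeOrderedRegion.preimage hπc).inter (isOpen_timeOrderedRegion.preimage hρc)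
  have hcont : ContinuousOn (fun x => 𝔚 (euclideanPoint x)) (timeOrderedRegion d n) :=
    h𝔚.continuousOn.comp continuous_euclideanPoint.continuousOn
      mapsTo_euclideanPoint_timeOrderedRegion
  have hG : ContinuousOn (fun x => 𝔚 (euclideanPoint (π x))) U :=
    hcont.comp hπc.continuousOn fun x hx => hx.1
  have hG' : ContinuousOn (fun x => 𝔚 (euclideanPoint (ρ x))) U :=
    hcont.comp hρc.continuousOn fun x hx => hx.2
  refine eqOn_of_integral_mul_eq_of_isOpen hUo hG hG' (fun F hFU _ => ?_) (Set.mem_inter hwσ hwR)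
  -- (E3) `∫ 𝔚(ι(x ∘ σ)) F(x) dx = 𝔖ₙ(F)`
  have hπF : IsTimeOrdered (permTest σ⁻¹ F) := by
    intro v hv
    rw [tsupport_permTest, Set.mem_preimage, permHomeo_apply] at hv
    have h1 : (fun k => v (σ⁻¹ k)) ∈ U := hFU hv
    have h2 := h1.1
    simp only [hπ, Set.mem_preimage] at h2
    have : (fun k => (fun k => v (σ⁻¹ k)) (σ k)) = v := by
      funext k; simp
    rwa [this] at h2
  have hF : ∀ x, F x = permTest σ⁻¹ F (π x) := by
    intro x
    rw [permTest_apply]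
    congr 1
    funext k
    simp [hπ]
  have h3 : ∫ x, 𝔚 (euclideanPoint (π x)) * F x = S n F := by
    calc ∫ x, 𝔚 (euclideanPoint (π x)) * F x
        = ∫ x, (fun v => 𝔚 (euclideanPoint v) * permTest σ⁻¹ F v) (π x) := by
          congr 1; funext x; rw [hF x]
      _ = ∫ v, 𝔚 (euclideanPoint v) * permTest σ⁻¹ F v :=
          integral_comp_perm_spaceTime σ (fun v => 𝔚 (euclideanPoint v) * permTest σ⁻¹ F v)
      _ = S n (permTest σ⁻¹ F) := (hS _ hπF).symm
      _ = S n F := hE3 n σ⁻¹ F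
  -- (E1) `∫ 𝔚(ι(R x)) F(x) dx = 𝔖ₙ(F)`
  have hLF : IsTimeOrdered (linActMulti L F) := by
    intro v hv
    set e : (Fin n → EuclideanSpace ℝ (Fin (d + 1))) ≃ₜ (Fin n → EuclideanSpace ℝ (Fin (d + 1))) :=
      (ContinuousLinearEquiv.piCongrRight fun _ : Fin n =>
        L.symm.toContinuousLinearEquiv).toHomeomorph
    have hcomp : ((linActMulti L F : 𝓢(_, ℂ)) : (Fin n → EuclideanSpace ℝ (Fin (d + 1))) → ℂ) =
        (F : (Fin n → EuclideanSpace ℝ (Fin (d + 1))) → ℂ) ∘ e := by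
      funext y; rfl
    rw [hcomp, tsupport_comp_eq_preimage] at hv
    have hv' : ρ (e v) ∈ timeOrderedRegion d n := (hFU hv).2
    have hρe : ρ (e v) = v := funext fun k => L.apply_symm_apply (v k)
    rwa [hρe] at hv'
  have hmp : MeasurePreserving ρ := volume_preserving_pi fun _ : Fin n => L.measurePreserving
  set em : (Fin n → EuclideanSpace ℝ (Fin (d + 1))) ≃ᵐ (Fin n → EuclideanSpace ℝ (Fin (d + 1))) :=
    (ContinuousLinearEquiv.piCongrRight fun _ : Fin n =>
      L.toContinuousLinearEquiv).toHomeomorph.toMeasurableEquiv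
  have hem : MeasurePreserving em := hmp
  have hcv := hem.integral_comp' (fun y => 𝔚 (euclideanPoint y) * linActMulti L F y)
  have hem_apply : ∀ x, em x = ρ x := fun x => rfl
  have h4 : ∫ x, 𝔚 (euclideanPoint (ρ x)) * F x = S n F := by
    calc ∫ x, 𝔚 (euclideanPoint (ρ x)) * F x
        = ∫ x, 𝔚 (euclideanPoint (em x)) * linActMulti L F (em x) := by
          congr 1; funext x
          rw [hem_apply, linActMulti_apply]
          congr 2
          funext k
          exact (L.symm_apply_apply (x k)).symm
      _ = ∫ y, 𝔚 (euclideanPoint y) * linActMulti L F y := hcv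
      _ = S n (linActMulti L F) := (hS _ hLF).symm
      _ = S n F := hE1.linActMulti n L F
  rw [h3, h4]

/-! ### The functional equation on the tube -/

/-- **The permuted OS continuation is the continuation composed with an imaginary boost.** Let
`𝔚` be the OS continuation of `𝔖ₙ` (E1, E3, holomorphic on `𝒯ₙ`, Euclidean restriction `𝔖ₙ` on
time-ordered test functions), `σ` a permutation and `B = B_i(iφ)` the complex boost of imaginary
rapidity in the `(0, i)`-plane. If `z ∘ σ ∈ 𝒯ₙ` and `B z ∈ 𝒯ₙ` then `𝔚(z ∘ σ) = 𝔚(B z)`.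
(Convex open domain `σ𝒯ₙ ∩ B⁻¹𝒯ₙ`, stable under `z ↦ ι(Re_E z)` because
`Re_E(z ∘ σ) = (Re_E z) ∘ σ` and `Re_E(B z) = R_φ(Re_E z)`; agreement at its Euclidean points by
`apply_euclideanPoint_perm_eq_planeRot`; `eqOn_zero_of_euclidean_of_convex`.) This is the
analytic content of Osterwalder–Schrader I, §4.5, first step ("symmetric analytic continuation
into `⋃_π π𝒯ₙ` … from (E3), (4.1), (4.12), (4.14)"), in the form used for locality.
[cite: OsterwalderSchraderCMP1973, §4.5] -/
theorem apply_perm_eq_apply_boostC (hE1 : S.IsEuclideanCovariant) (hE3 : S.IsSymmetric)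
    (h𝔚 : DifferentiableOn ℂ 𝔚 (forwardTube d n))
    (hS : ∀ F : 𝓢((Fin n → EuclideanSpace ℝ (Fin (d + 1))), ℂ), IsTimeOrdered F →
      S n F = ∫ x, 𝔚 (euclideanPoint x) * F x)
    (σ : Equiv.Perm (Fin n)) (i : Fin d) (φ : ℝ) {z : Fin n → Fin (d + 1) → ℂ}
    (hzσ : (fun k => z (σ k)) ∈ forwardTube d n)
    (hzB : boostConfig n i ((φ : ℂ) * I) z ∈ forwardTube d n) :
    𝔚 (fun k => z (σ k)) = 𝔚 (boostConfig n i ((φ : ℂ) * I) z) := by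
  set πC : (Fin n → Fin (d + 1) → ℂ) → (Fin n → Fin (d + 1) → ℂ) := fun z k => z (σ k) with hπC
  set B := boostConfig n i ((φ : ℂ) * I) with hB
  have hπCl : IsLinearMap ℂ πC := ⟨fun _ _ => rfl, fun _ _ => rfl⟩
  have hπCc : Continuous πC := continuous_pi fun k => continuous_apply (σ k)
  have hπCd : Differentiable ℂ πC := hπCl.mk'.toContinuousLinearMap |>.differentiable
  set D : Set (Fin n → Fin (d + 1) → ℂ) := πC ⁻¹' forwardTube d n ∩ B ⁻¹' forwardTube d n with hD
  have hDo : IsOpen D := (isOpen_forwardTube.preimage hπCc).inter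
    (isOpen_forwardTube.preimage (continuous_boostConfig i _))
  have hDc : Convex ℝ D := by
    refine Convex.inter ?_ ?_
    · intro a ha b hb s t hs ht hst
      show πC (s • a + t • b) ∈ forwardTube d n
      have : πC (s • a + t • b) = s • πC a + t • πC b := rfl
      rw [this]; exact convex_forwardTube ha hb hs ht hst
    · intro a ha b hb s t hs ht hst
      show B (s • a + t • b) ∈ forwardTube d n
      rw [hB, boostConfig_add, boostConfig_smul_real, boostConfig_smul_real]
      exact convex_forwardTube ha hb hs ht hst
  have hP : ∀ z ∈ D, euclideanPoint (euclideanRe z) ∈ D := by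
    intro z hz
    refine ⟨?_, ?_⟩
    · -- `ι(Re_E z) ∘ σ = ι(Re_E (z ∘ σ)) ∈ 𝒯ₙ` (`QuantumLattice.euclideanPoint_comp_perm`,
      -- `euclideanRe_comp_perm`, both definitional)
      show (fun k => euclideanPoint (euclideanRe z) (σ k)) ∈ forwardTube d n
      exact mapsTo_euclideanPoint_timeOrderedRegion (euclideanRe_mem_timeOrderedRegion hz.1)
    · -- `B ι(Re_E z) = ι(R (Re_E z)) = ι(Re_E (B z)) ∈ 𝒯ₙ`
      show B (euclideanPoint (euclideanRe z)) ∈ forwardTube d n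
      rw [hB, boostConfig_mul_I_euclideanPoint, ← euclideanRe_boostConfig_mul_I]
      exact mapsTo_euclideanPoint_timeOrderedRegion (euclideanRe_mem_timeOrderedRegion hz.2)
  set g : (Fin n → Fin (d + 1) → ℂ) → ℂ := fun z => 𝔚 (πC z) - 𝔚 (B z) with hg
  have hgd : DifferentiableOn ℂ g D :=
    (h𝔚.comp hπCd.differentiableOn fun z hz => hz.1).sub
      (h𝔚.comp (differentiable_boostConfig i _).differentiableOn fun z hz => hz.2)
  have h0 : ∀ w : Fin n → EuclideanSpace ℝ (Fin (d + 1)), euclideanPoint w ∈ D →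
      g (euclideanPoint w) = 0 := by
    intro w hw
    have hwσ : (fun k => w (σ k)) ∈ timeOrderedRegion d n := by
      rw [← euclideanPoint_mem_forwardTube_iff]; exact hw.1
    have hwR : (fun k => planeRot i φ (w k)) ∈ timeOrderedRegion d n := by
      rw [← euclideanPoint_mem_forwardTube_iff, ← boostConfig_mul_I_euclideanPoint]; exact hw.2
    simp only [hg]
    rw [sub_eq_zero, show πC (euclideanPoint w) = euclideanPoint (fun k => w (σ k)) from rfl,
      hB, boostConfig_mul_I_euclideanPoint]
    exact apply_euclideanPoint_perm_eq_planeRot hE1 hE3 h𝔚 hS σ i φ hwσ hwR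
  have hz : z ∈ D := ⟨hzσ, hzB⟩
  have := eqOn_zero_of_euclidean_of_convex hDo hDc hP hgd h0 hz
  simpa [hg, sub_eq_zero] using this

end Literature.MathematicalPhysics.QuantumFieldTheory
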